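import Literature.MathematicalPhysics.QuantumFieldTheory.King1986.UniformDecay
import Literature.MathematicalPhysics.QuantumFieldTheory.Balaban1983to89.NE2NodeTorus
import Literature.MathematicalPhysics.QuantumFieldTheory.Balaban1983to89.B5Hk163TorusHolderRate

/-!
# BalabanUVNodes ∕ N15 — THE KING-MODEL RUNG, READOUT: the four (3.42) operator entries of a TWO-POINT kernel on the knit
# lineage's operator carrier `torusOpGeo`, and the dictionary «King's unit-torus distance = the carrier's distance»
# (Track A, DAG node N15 = NE2; FAN-OUT v1.1 §N15 s3 «KING-MODEL ∕ RIEMANN-KERNEL RUNG», section 1 of 3)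

HONEST FRAMING.  Count-neutral kernel bookkeeping (cell `pub-ymgap`, seat `pub-ymgap-dag-n15-e` g0, strategy s3 «alternative
currency»; `--supports stmt-QuantumFields-19676` = K3 `SpineGivenEndpointR11`).  [folklore] finite sums on a finite torus; nothing of
Bałaban's or King's is asserted here; NE2⁺ NOT PRINTED ∕ not proved; NOT a node discharge; nothing continuum ∕ ℝ⁴ ∕ OS ∕ mass-gap ∕
Clay.  0 `sorry`, standard axioms; three plumbing `def`s (`app₂`, `opEntries₂`, `opKernelFamily₂`).

WHY.  The King-model rung (sections 2–3: `BalabanUVNodesN15KingModelRung`, `…RungUnit`) decides node N15's three NE2 layers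
(`T4EtaRate.NE2PlusOperator ∕ NE2PlusSite ∕ NE2PlusUnit` on ONE family) in King's `A = 0` scalar model for King's OWN objects —
the propagator top-scale piece `G^η_{(K)}` ([King1986] (4.44), Prop. 3.9 p. 675) and the block-field covariance `(Δ^{(K)})⁻¹`.
Read at the base points of unit blocks these are genuine TWO-POINT kernels `K(y, z)` on the unit torus, while the lineage's
operator-layer readout `T4EtaRateOperatorTorus.opKernelFamily ∕ etaRateIneq342_torus_of_site` takes a ONE-variable convolution
kernel.  This file supplies the two-point twin on the SAME carrier `torusOpGeo d L M k N` (sites = unit torus `Tor N`, test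
functions on it, `suppIn λ y′` = point support, sup norm):
* `tdistT_eq_dist`: King's `tdistT N y y′` (`King1986.UniformDecay`) IS the carrier's `torusSupNorm N (rep N (y − y′))`;
* `app₂ K λ y = Σ_z K(y, z)λ(z)`, `opEntries₂` = the four (3.42) entries `|Kλ|`, `Σ_μ|∇_μKλ|`, `Σ_μ|K∇*_μλ|`, `|ΔKλ|`
  (unit-lattice derivatives `fdiffT ∕ fdiffAdjT ∕ lapT` of the lineage = the covariant ones at `U ≡ 1`), `opKernelFamily₂ K` the
  `B9.KernelFamily` they define (Hölder ∕ L² ∕ global entries inert, as in `opKernelFamily`);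
* **`opEntries₂_le`** ∕ **`etaRateIneq342_of_kernelBound₂`**: a kernel bound `|K(y, z)| ≤ A·e^{−δ|y − z|_T}·(L^{−γ})^k` gives
  `EtaRateIneq342 (opKernelFamily₂ K) (4(d+1)e^{δ}A) δ γ` — a point-supported argument collapses the sum, each entry sees at most
  `4(d+1)` kernel values one unit step from `(y, y′)`, each step costs `e^{δ}` (`kernel_le_shift`); constant `B0op d δ A` of the lineage.
Locators: [Balaban1985BackgroundPropagators] CMP 99 (1985) (3.42) p. 397, Thm 3.14 pp. 426–427 (typing template); [King1986] CMP 102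
(1986) p. 664 (pairing convention), Prop. 3.9 (3.73) p. 665 (rate factor).
-/

noncomputable section

namespace Summit.QuantumFields.YangMills.BalabanUVNodes.N15KingModelRung

open Real Finset
open Literature.MathematicalPhysics.QuantumFieldTheory.Balaban1983to89
open Literature.MathematicalPhysics.QuantumFieldTheory.Balaban1983to89.T4EtaRate (EtaRateIneq342 rateFactor)
open Literature.MathematicalPhysics.QuantumFieldTheory.Balaban1983to89.T4EtaRateSiteTorus (torusSupNorm_rep_toT)
open Literature.MathematicalPhysics.QuantumFieldTheory.Balaban1983to89.T4EtaRateOperatorTorus (torusOpGeo fdiffT fdiffAdjT lapT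
  B0op abs_le_supNorm_op torusOpGeo_len torusOpGeo_dist rateFactor_torusOpGeo pref4_one sum_const_fin)
open Literature.MathematicalPhysics.QuantumFieldTheory.Balaban1983to89.T4EtaRateDefectSite (pt9Bg)
open Literature.MathematicalPhysics.QuantumFieldTheory.Balaban1983to89.B5Prop11Plancherel (Tor unitVec)
open Literature.MathematicalPhysics.QuantumFieldTheory.Balaban1983to89.B6LowerBound2153Torus (toT rep toT_rep)
open Literature.MathematicalPhysics.QuantumFieldTheory.Balaban1983to89.B4TorusKernel.MultiPeriod (torusSupNorm)
open Literature.MathematicalPhysics.QuantumFieldTheory.King1986.Torus (tdistT tdistT_triangle tdistT_symm tdistT_add_unitVec_le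
  tdistT_sub_unitVec_le)

variable {d : ℕ}

/-! ## §1 The distance dictionary -/

section Readout

variable {N : Fin (d + 1) → ℕ} [∀ μ, NeZero (N μ)]

omit [∀ μ, NeZero (N μ)] in
/-- The quotient map `ℤ^{d+1} → Tor N` is compatible with subtraction. [folklore] -/
theorem toT_sub (x y : Fin (d + 1) → ℤ) : toT N (x - y) = toT N x - toT N y := by
  funext i
  simp only [toT, Pi.sub_apply, Int.cast_sub]

/-- **KING'S UNIT-TORUS DISTANCE IS THE OPERATOR CARRIER'S DISTANCE**: `tdistT N y y′ = |rep(y − y′)|_{T,∞}` — King's `tdistT`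
(`UniformDecay`) and the knit lineage's `torusSupNorm N (rep N (y − y′))` (`torusOpGeo_dist`) read the same circular coordinate
distances. [folklore] -/
theorem tdistT_eq_dist (y y' : Tor N) : tdistT N y y' = torusSupNorm N (rep N (y - y')) := by
  have h1 : tdistT N y y' = torusSupNorm N (rep N y - rep N y') := by
    rw [B5Hk163TorusHolderRate.torusSupNorm_sub_rep N (rep N y) y', toT_rep]
    rfl
  have h2 : toT N (rep N y - rep N y') = y - y' := by rw [toT_sub, toT_rep, toT_rep]
  rw [h1, ← h2, torusSupNorm_rep_toT]

/-- THE OPERATOR OF A TWO-POINT KERNEL on the unit torus: `(Kλ)(y) = Σ_z K(y, z)λ(z)`. [folklore] -/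
def app₂ (K : Tor N → Tor N → ℝ) (lam : Tor N → ℝ) (y : Tor N) : ℝ := ∑ z, K y z * lam z

/-- A point-supported argument collapses the sum: `supp λ ⊂ {y′} ⇒ (Kλ)(y) = K(y, y′)λ(y′)`. [folklore] -/
theorem app₂_of_suppIn {K : Tor N → Tor N → ℝ} {lam : Tor N → ℝ} {y' : Tor N} (hs : ∀ z, lam z ≠ 0 → z = y') (y : Tor N) :
    app₂ K lam y = K y y' * lam y' := by
  unfold app₂
  rw [Finset.sum_eq_single y']
  · intro z _ hz
    have h0 : lam z = 0 := by
      by_contra h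
      exact hz (hs z h)
    rw [h0, mul_zero]
  · intro h
    exact absurd (Finset.mem_univ y') h

/-- … and `(K∇*_μλ)(y) = K(y, y′ + e_μ)λ(y′) − K(y, y′)λ(y′)` (the shifted argument `z ↦ λ(z − e_μ)` is supported at `y′ + e_μ`).
[folklore] -/
theorem app₂_fdiffAdjT_of_suppIn {K : Tor N → Tor N → ℝ} {lam : Tor N → ℝ} {y' : Tor N} (hs : ∀ z, lam z ≠ 0 → z = y')
    (μ : Fin (d + 1)) (y : Tor N) :
    app₂ K (fdiffAdjT μ lam) y = K y (y' + unitVec N μ) * lam y' - K y y' * lam y' := by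
  have hsplit : app₂ K (fdiffAdjT μ lam) y = app₂ K (fun z => lam (z - unitVec N μ)) y - app₂ K lam y := by
    simp only [app₂, fdiffAdjT, mul_sub, Finset.sum_sub_distrib]
  have hs' : ∀ z, (fun z => lam (z - unitVec N μ)) z ≠ 0 → z = y' + unitVec N μ := by
    intro z hz
    have h := hs (z - unitVec N μ) hz
    rw [← h, sub_add_cancel]
  rw [hsplit, app₂_of_suppIn hs' y, app₂_of_suppIn hs y]
  simp only [add_sub_cancel_right]

/-- THE FOUR (3.42) ENTRIES of the operator of the two-point kernel `K` at argument `λ` and observation site `y` in the collapsed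
model: `|(Kλ)(y)|`, `Σ_μ |(∇_μKλ)(y)|`, `Σ_μ |(K∇*_μλ)(y)|`, `|(ΔKλ)(y)|` (unit-lattice derivatives = the covariant ones at `U ≡ 1`).
[cite: Balaban1985BackgroundPropagators, (3.42) p.397 (the four entries, shape)] -/
def opEntries₂ (K : Tor N → Tor N → ℝ) (lam : Tor N → ℝ) (y : Tor N) : Fin 4 → ℝ :=
  ![|app₂ K lam y|, ∑ μ, |fdiffT μ (app₂ K lam) y|, ∑ μ, |app₂ K (fdiffAdjT μ lam) y|, |lapT (app₂ K lam) y|]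

/-- THE OPERATOR-LAYER KERNEL FAMILY OF A TWO-POINT KERNEL `K` on the operator carrier `torusOpGeo d L M k N` (one-point
backgrounds): entries `e n` = `opEntries₂ K`; the Hölder ∕ `L²` ∕ global entries are INERT (`0`; (3.43)–(3.47) not modelled — as
in the lineage's `opKernelFamily`). [cite: Balaban1985BackgroundPropagators, (3.42) p.397 + Thm 3.14 pp.426–427 (typing template)] -/
def opKernelFamily₂ (K : Tor N → Tor N → ℝ) (L M : ℝ) (k : ℕ) : B9.KernelFamily (torusOpGeo d L M k N) pt9Bg where
  e := fun n _ lam y => opEntries₂ K lam y n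
  h1 := fun _ _ _ _ => 0
  e4 := fun _ _ _ => 0
  h2 := fun _ _ _ _ => 0
  l2 := fun _ _ _ _ => 0
  glob := fun _ _ _ _ => 0

/-- Unfolding of the entries of `opKernelFamily₂`. [folklore] -/
@[simp] theorem opKernelFamily₂_e (K : Tor N → Tor N → ℝ) (L M : ℝ) (k : ℕ) (n : Fin 4) (U : pt9Bg.Cfg)
    (lam : (torusOpGeo d L M k N).Loc) (y : Tor N) :
    (opKernelFamily₂ (N := N) K L M k).e n U lam y = opEntries₂ K lam y n := rfl

variable {K : Tor N → Tor N → ℝ} {A δ R : ℝ}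

/-- A kernel under the weight `A·e^{−δ|y − z|_T}·R` has `A·R ≥ 0`. [folklore] -/
theorem ar_nonneg (hB : ∀ y z, |K y z| ≤ A * Real.exp (-(δ * tdistT N y z)) * R) (y : Tor N) : 0 ≤ A * R := by
  have h := (abs_nonneg _).trans (hB y y)
  rw [mul_right_comm] at h
  exact (mul_nonneg_iff_of_pos_right (Real.exp_pos _)).mp h

/-- ONE UNIT STEP COSTS `e^{δ}`: if `|y − z|_T ≤ |y₁ − z₁|_T + 1` then `|K(y₁, z₁)| ≤ e^{δ}·A·e^{−δ|y − z|_T}·R` (`δ ≥ 0`). [folklore] -/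
theorem kernel_le_shift (hB : ∀ y z, |K y z| ≤ A * Real.exp (-(δ * tdistT N y z)) * R) (hδ : 0 ≤ δ) {y z y₁ z₁ : Tor N}
    (h : tdistT N y z ≤ tdistT N y₁ z₁ + 1) :
    |K y₁ z₁| ≤ Real.exp δ * (A * Real.exp (-(δ * tdistT N y z)) * R) := by
  refine (hB y₁ z₁).trans ?_
  have hAR := ar_nonneg hB y
  have hexp : Real.exp (-(δ * tdistT N y₁ z₁)) ≤ Real.exp δ * Real.exp (-(δ * tdistT N y z)) := by
    rw [← Real.exp_add]
    exact Real.exp_le_exp.mpr (by nlinarith [mul_le_mul_of_nonneg_left h hδ])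
  calc A * Real.exp (-(δ * tdistT N y₁ z₁)) * R = (A * R) * Real.exp (-(δ * tdistT N y₁ z₁)) := by ring
    _ ≤ (A * R) * (Real.exp δ * Real.exp (-(δ * tdistT N y z))) := mul_le_mul_of_nonneg_left hexp hAR
    _ = Real.exp δ * (A * Real.exp (-(δ * tdistT N y z)) * R) := by ring

/-- The four admissible steps: `(y, z)`, `(y ± e_μ, z)`, `(y, z + e_μ)` are within one unit of `(y, z)`. [folklore] -/
theorem step_self (y z : Tor N) : tdistT N y z ≤ tdistT N y z + 1 := by linarith

/-- see `step_self`. [folklore] -/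
theorem step_add (y z : Tor N) (μ : Fin (d + 1)) : tdistT N y z ≤ tdistT N (y + unitVec N μ) z + 1 := by
  have h1 := tdistT_triangle N y (y + unitVec N μ) z
  have h2 := tdistT_add_unitVec_le N y μ
  linarith

/-- see `step_self`. [folklore] -/
theorem step_sub (y z : Tor N) (μ : Fin (d + 1)) : tdistT N y z ≤ tdistT N (y - unitVec N μ) z + 1 := by
  have h1 := tdistT_triangle N y (y - unitVec N μ) z
  have h2 := tdistT_sub_unitVec_le N y μ
  linarith

/-- see `step_self`. [folklore] -/
theorem step_arg (y z : Tor N) (μ : Fin (d + 1)) : tdistT N y z ≤ tdistT N y (z + unitVec N μ) + 1 := by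
  have h1 := tdistT_triangle N y (z + unitVec N μ) z
  have h2 := tdistT_add_unitVec_le N z μ
  rw [tdistT_symm] at h2
  linarith

variable {lam : Tor N → ℝ} {y' : Tor N} {s : ℝ}

/-- **THE FOUR ENTRIES UNDER A TWO-POINT KERNEL BOUND**: for `supp λ ⊂ {y′}`, `|λ(y′)| ≤ s`, `δ ≥ 0` and
`|K(y, z)| ≤ A·e^{−δ|y − z|_T}·R`, every entry is `≤ 4(d+1)e^{δ}·A·e^{−δ|y − y′|_T}·R·s`. [cite: Balaban1985BackgroundPropagators, (3.42) p.397 (shape)] [folklore] -/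
theorem opEntries₂_le (hB : ∀ y z, |K y z| ≤ A * Real.exp (-(δ * tdistT N y z)) * R) (hδ : 0 ≤ δ)
    (hs : ∀ z, lam z ≠ 0 → z = y') (hsz : |lam y'| ≤ s) (y : Tor N) (n : Fin 4) :
    opEntries₂ K lam y n ≤ B0op d δ A * Real.exp (-(δ * tdistT N y y')) * R * s := by
  set W : ℝ := A * Real.exp (-(δ * tdistT N y y')) * R with hW
  have hW0 : 0 ≤ W := by
    rw [hW, mul_right_comm]
    exact mul_nonneg (ar_nonneg hB y) (Real.exp_pos _).le
  have hs0 : 0 ≤ s := (abs_nonneg _).trans hsz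
  have he : 1 ≤ Real.exp δ := Real.one_le_exp hδ
  have hEW : 0 ≤ Real.exp δ * W := mul_nonneg (Real.exp_pos _).le hW0
  -- the four kernel values that occur, each `≤ e^{δ}·W`
  have k0 : |K y y'| ≤ Real.exp δ * W := kernel_le_shift hB hδ (step_self y y')
  have k1 : ∀ μ, |K (y + unitVec N μ) y'| ≤ Real.exp δ * W := fun μ => kernel_le_shift hB hδ (step_add y y' μ)
  have k2 : ∀ μ, |K (y - unitVec N μ) y'| ≤ Real.exp δ * W := fun μ => kernel_le_shift hB hδ (step_sub y y' μ)
  have k3 : ∀ μ, |K y (y' + unitVec N μ)| ≤ Real.exp δ * W := fun μ => kernel_le_shift hB hδ (step_arg y y' μ)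
  -- the values of the operator that occur
  have v : ∀ t, app₂ K lam t = K t y' * lam y' := fun t => app₂_of_suppIn hs t
  have hprod : ∀ {x : ℝ}, |x| ≤ Real.exp δ * W → |x * lam y'| ≤ Real.exp δ * W * s := fun hx => by
    rw [abs_mul]; exact mul_le_mul hx hsz (abs_nonneg _) hEW
  have a0 : |app₂ K lam y| ≤ Real.exp δ * W * s := by rw [v]; exact hprod k0
  have a1 : ∀ μ, |app₂ K lam (y + unitVec N μ)| ≤ Real.exp δ * W * s := fun μ => by rw [v]; exact hprod (k1 μ)
  have a2 : ∀ μ, |app₂ K lam (y - unitVec N μ)| ≤ Real.exp δ * W * s := fun μ => by rw [v]; exact hprod (k2 μ)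
  have a3 : ∀ μ, |app₂ K (fdiffAdjT μ lam) y| ≤ 2 * (Real.exp δ * W * s) := fun μ => by
    rw [app₂_fdiffAdjT_of_suppIn hs μ y]
    exact (abs_sub _ _).trans (by linarith [hprod (k3 μ), hprod k0])
  have hgoal : B0op d δ A * Real.exp (-(δ * tdistT N y y')) * R * s = 4 * (((d : ℝ) + 1) * (Real.exp δ * W * s)) := by
    rw [hW, B0op]; ring
  rw [hgoal]
  have hEWs : 0 ≤ Real.exp δ * W * s := mul_nonneg hEW hs0
  have hd1 : (1 : ℝ) ≤ (d : ℝ) + 1 := by linarith [(Nat.cast_nonneg d : (0 : ℝ) ≤ d)]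
  fin_cases n
  · -- entry 0
    show |app₂ K lam y| ≤ _
    calc |app₂ K lam y| ≤ Real.exp δ * W * s := a0
      _ = 1 * (1 * (Real.exp δ * W * s)) := by ring
      _ ≤ 4 * (((d : ℝ) + 1) * (Real.exp δ * W * s)) := by gcongr; norm_num
  · -- entry 1
    show ∑ μ, |fdiffT μ (app₂ K lam) y| ≤ _
    calc ∑ μ, |fdiffT μ (app₂ K lam) y| ≤ ∑ _μ : Fin (d + 1), 2 * (Real.exp δ * W * s) :=
          Finset.sum_le_sum fun μ _ => (abs_sub _ _).trans (by linarith [a1 μ, a0])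
      _ = 2 * (((d : ℝ) + 1) * (Real.exp δ * W * s)) := by rw [sum_const_fin]; ring
      _ ≤ 4 * (((d : ℝ) + 1) * (Real.exp δ * W * s)) := by gcongr; norm_num
  · -- entry 2
    show ∑ μ, |app₂ K (fdiffAdjT μ lam) y| ≤ _
    calc ∑ μ, |app₂ K (fdiffAdjT μ lam) y| ≤ ∑ _μ : Fin (d + 1), 2 * (Real.exp δ * W * s) :=
          Finset.sum_le_sum fun μ _ => a3 μ
      _ = 2 * (((d : ℝ) + 1) * (Real.exp δ * W * s)) := by rw [sum_const_fin]; ring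
      _ ≤ 4 * (((d : ℝ) + 1) * (Real.exp δ * W * s)) := by gcongr; norm_num
  · -- entry 3
    show |lapT (app₂ K lam) y| ≤ _
    unfold lapT
    calc |∑ μ, (app₂ K lam (y + unitVec N μ) + app₂ K lam (y - unitVec N μ) - 2 * app₂ K lam y)|
        ≤ ∑ μ, |app₂ K lam (y + unitVec N μ) + app₂ K lam (y - unitVec N μ) - 2 * app₂ K lam y| :=
          Finset.abs_sum_le_sum_abs _ _
      _ ≤ ∑ _μ : Fin (d + 1), 4 * (Real.exp δ * W * s) := Finset.sum_le_sum fun μ _ => by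
          have h2 : |2 * app₂ K lam y| ≤ 2 * (Real.exp δ * W * s) := by
            rw [abs_mul, abs_two]; exact mul_le_mul_of_nonneg_left a0 zero_le_two
          exact (abs_sub _ _).trans ((add_le_add (abs_add_le _ _) le_rfl).trans (by linarith [a1 μ, a2 μ, h2]))
      _ = 4 * (((d : ℝ) + 1) * (Real.exp δ * W * s)) := by rw [sum_const_fin]; ring

/-- **THE READOUT FOR TWO-POINT KERNELS** (one `(N, k, M)`; `L > 0`, `δ ≥ 0`): a kernel bound
`|K(y, z)| ≤ A·e^{−δ|y − z|_T}·(L^{−γ})^k` IMPLIES the typed operator-layer inequality (the four (3.42) entries with King's rate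
factor) for `opKernelFamily₂ K` on the operator carrier, with constants `(B0op d δ A, δ, γ) = (4(d+1)e^{δ}A, δ, γ)`.
[cite: Balaban1985BackgroundPropagators, (3.42) p.397 + Thm 3.14 pp.426–427 (quantifier template); King1986, Prop. 3.9 (3.73) p.665 (rate factor)] [folklore] -/
theorem etaRateIneq342_of_kernelBound₂ {L : ℝ} (hL : 0 < L) (M : ℝ) (k : ℕ) {γ : ℝ} {U : pt9Bg.Cfg}
    (hB : ∀ y z, |K y z| ≤ A * Real.exp (-(δ * tdistT N y z)) * (L ^ (-γ)) ^ k) (hδ : 0 ≤ δ) :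
    EtaRateIneq342 (opKernelFamily₂ (N := N) K L M k) (B0op d δ A) δ γ U := by
  intro n lam y y' hs
  rw [opKernelFamily₂_e, torusOpGeo_len N hL.ne', pref4_one, mul_one, rateFactor_torusOpGeo N hL,
    rateFactor_torusOpGeo N hL, max_self, torusOpGeo_dist, ← tdistT_eq_dist]
  exact opEntries₂_le hB hδ hs (abs_le_supNorm_op N L M k lam y') y n

end Readout

end Summit.QuantumFields.YangMills.BalabanUVNodes.N15KingModelRung

end
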